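import Literature.MathematicalPhysics.QuantumFieldTheory.Balaban1983to89.Node00.OpsYGpUnits
import Literature.MathematicalPhysics.QuantumFieldTheory.Balaban1983to89.Node00.OpsYSectDESymm
import Literature.MathematicalPhysics.QuantumFieldTheory.Balaban1983to89.Node00.OpsYQOnto
import Literature.MathematicalPhysics.QuantumFieldTheory.Balaban1983to89.B9Eq3132NuReading

/-!
# `Balaban1983to89.Node00.OpsYRecordV4P` — T. Bałaban, *Propagators for lattice gauge theories in a background field*, Commun. Math. Phys. **99**
# (1985) 389–434 [Balaban1985BackgroundPropagators], (3.24)–(3.27) pp. 394–395 and (3.119)–(3.153) pp. 419–426: THE v4 RECORD WITH ITS SECT. D∕E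
# COMPOSITES FED THE PRINT-UNITS SITE PROPAGATOR `G′_phys(U) = η²·G′_latt(U)` — `covLettersY_v4P`, `lettersYOfRecordV4P`, `opsYOfRecordV4PE`, `opsYNuOfRecordV4PE`

statement-level skeleton of published theorems with citation tags; proofs where landed; nothing here is a claim about the Yang–Mills mass gap

THE PRINT.  p. 394: *«Δ′_a(U) = Δ_U + Σ_j a_j(L^jη)^{−2} Q′_j(U)*Q′_j(U) (3.24) … Its inverse is denoted by G′, or G′(U)»*, *«R(U) = I − G′Q′*(Q′G′²Q′*)^{−1}Q′G′
(3.25)»*; p. 395: *«Δ_a(U) = Δ(U) + D_U R(U) D*_U + Q*(U)aQ(U) (3.26)»*, *«G(U) = Δ_a(U)^{−1} (3.27)»*.  p. 419: *«⟨A, Δ_πA⟩ = ⟨A − DG′RD*A, Δ(A − DG′RD*A)⟩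
(3.119)»*; p. 420: *«Δ_{π,a} = Δ_π + DRD* + Q*aQ (3.122) … G̃ = Δ_{π,a}^{−1} (3.123) … H = G̃Q*(QG̃Q*)^{−1} (3.126)»*; p. 421: *«G₁ = (Δ_{π,a} − Δ⁽²⁾_π)^{−1}
(3.128), H₁ = G₁Q*(QG₁Q*)^{−1} (3.129)»*; p. 422: *«(QG₁Q*)^{−1} (3.132)»*; p. 426: *«𝔊 = 𝔓G₁ (3.153)»*.  Print's units are the physical ones of the `η`-lattice
throughout (pp. 390–392: `η = L^{−k}` in (3.3), (3.8) and in the scalar products).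

WHY THIS FILE (pub-ymgap bus, 2026-08-27: dag-n06-l LOCATED-UNITS-D1, def-Y FILE 28 `Node00.OpsYGpUnits`, dag-n06-d ASK-1, dag-n06-i's probed blueprint).
NODE 00's SITE sector is typed in LATTICE units (`GpY = (Δ′_{a,latt})⁻¹`, `deltaPrimeAY_one = liftOpY mlOpT`), its BOND sector and the Sect. D
composites in PHYSICAL units; the composites `GDY ∕ QGQinvY ∕ HDY ∕ G1Y ∕ QG1QinvY ∕ H1Y ∕ GGY` take the site propagator as a PARAMETER `Gp` and denote
print's (3.119)–(3.153) only when fed `G′_phys = η²·G′_latt` (`Node00.GpPhysY`, FILE 28).  The v4 record `lettersYOfRecordV4` (`Node00.OpsYRecordV4`)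
feeds them `GpY`.  This file is the record the N06 certificate's next edition instantiates: the SEVEN operator fields `GD, QGQinv, H, G₁, QG1Qinv, H₁,
GG` of the v4 family RE-FED `GpPhysY`, every other field kept — the transporters `parSymY ∕ parBY`; the raw `G′ = GpY` with its printed `U = 1` law
(`CovLettersY.Gp_one` pins `.Gp` to the lattice `G♯` of [4] (2.19), which `GpPhysY` violates by the factor `η²`, `GpPhysY_one_liftY` — so `.Gp` is NOT
re-based, and the (3.42) ∕ (3.48) readings of `G′ ∕ C`, whose weights `kernelFamilyS.e = (2,1,1,0)` ∕ `cWtY ∋ η⁻⁴` already convert, stay on `GpY`);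
`G = Δ_a⁻¹` (blind to the units of `G′`, FILE 28 `GAY_GpPhysY` — below `covLettersY_v4P_GA_phys`); `C`; `Kdiff = G − G(Ω′)`; the flat `P349 ∕ Ck` slots.

WHAT THIS FILE DOES (definitions + `rfl` ∕ one-rewrite algebra):
* §1 the generic updater `CovLettersY.withSectDEAt 𝔏 Gp' Δ2` — the Sect. D∕E operator fields rebuilt over the record's own `parS ∕ parB`, an ARBITRARY
  site propagator `Gp'` and a residual letter `Δ2` (no law field touched); its field lemmas; `withSectD (𝔏.withDE GA' 𝔯)` is the update at `𝔏.Gp`.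
* §2 ★ the member family `covLettersY_v4P 𝔸 x 𝔯 := (covLettersY_v4 𝔸 x 𝔯).withSectDEAt (GpPhysY … (parSymY …)) 𝔯.Δ2`: field lemmas (the seven
  composites AT `GpPhysY`, the rest v4's, all `rfl`); `G` is ALSO `GAY … (GpPhysY …)`; the two (3.132) letters as `Ring.inverse` of named operators; the
  seven `U = 1` faces `= v4's` (FILE 28's transfer); gauge covariance (3.33)–(3.34) (`GpPhysY_isCovSiteOpY`).
* §3 (`𝔸 = M_N(ℂ)`) trace-symmetry: a real multiple of a symmetric operator is symmetric, `G′_phys(U)` and `R[G′_phys](U) = R[G′_latt](U)` are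
  symmetric at `G`-valued `U`, hence `G_D ∕ G₁ ∕ 𝔊` over `parSymY ∕ parBY ∕ GpPhysY (parSymY)` are (FILE 19's engine); the unit `QG₁Q*` from
  `Δ⁽¹⁾ > 0` at these tables (FILE 24's engine).
* §4 ★★ the record `lettersYOfRecordV4P N θ M⋆ 𝔯`, its field lemmas, `hsymD`-shape symmetry `lettersYOfRecordV4P_symmDG₁GG`, covariance; ★★★ the two
  instances `opsYOfRecordV4PE` (def-Y's Sect.-E constructor over n06-i's site-(3.49) layer) and `opsYNuOfRecordV4PE` (the same over n06-i's `ν`-read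
  layer `opsYS349NuOfLetters` — the shape `B9Eq3132FacesAtLetters.s3132Nu_opsYSectE_of_step12` consumes), with the `rfl` transport of every field.

HONEST SCOPE.  Definitions and finite-dimensional linear algebra; no inequality of the paper is proved or asserted; the residual letter `Δ⁽²⁾` stays
the certificate's PARAMETER `𝔯` (an instantiated residual at `GpPhysY` is a later sibling); WHICH record a certificate elaborates against is the
certificate's edition.  Nothing landed is modified; N06 is NOT discharged; NOT continuum, NOT OS, NOT the mass gap.  Filed by the pub-ymgap def-Y
owner lineage (`pub-ymgap-node00-def-Y`, gen 17).  Net new unproved facts: 0.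
-/

namespace Literature.MathematicalPhysics.QuantumFieldTheory.Balaban1983to89.Node00

open B6KLevelCensusIndexV1 (KIdx)
open B9PinMembersKLevelV1 (MemberY geo9Y bg9Y)
open B9PinCarriersKLevelV1 (carriersY)
open B9PinGeometryKLevelV1 (inΛY unitDistY c35Y)
open B7Prop2SpecialUnitary (specialUnitaryUnits specialUnitaryUnits_le_unitaryUnits)
open B9Thm311ReadingCoords (trIP trIP_eq_re_trace IsSymmTr PosDefTr)
open B9Ineq349SiteAdjoint (trIP_comm isSymmTr_GpY_parSymY)
open B9Thm311ProjectionR (RY_parSymY_isSymmTr)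
open B9Eq3132SectDLetters (GDY QGQY QGQinvY HDY withSectD)
open B9Ineq349SiteReading (p349SiteY fineKernelOfSiteOp opsYS349OfLetters)
open B9Eq3132NuReading (siteKernelOfOpNu nuY opsYS349NuOfLetters opsYNuOfRecordV4E)
open scoped Matrix

noncomputable section

variable {d ℓ : ℕ} {hd : 1 ≤ d + 1} {hL : Odd (ℓ + 1) ∧ 1 < ℓ + 1} {b₀ b₁ : ℝ} {Mstar : ℕ}
variable {𝔸 : Type} [NormedRing 𝔸] [NormedAlgebra ℂ 𝔸] [CompleteSpace 𝔸]

/-! ## §1 The updater: the Sect. D∕E operator fields of a letters record at an ARBITRARY site propagator `G′` -/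

section Updater

variable {x : MemberY d ℓ hd hL b₀ b₁ Mstar}

/-- **RE-FEEDING THE SECT. D∕E COMPOSITES A SITE PROPAGATOR `G′`**: over the record's own transporters `parS ∕ parB`, an arbitrary site-sector letter
`Gp'` and a residual letter `Δ⁽²⁾`: `GD := G̃` (3.122)–(3.123), `QGQinv := (QG̃Q*)⁻¹` (3.123)∕(3.132), `H := G̃Q*(QG̃Q*)⁻¹` (3.126), `G₁` (3.128), `QG1Qinv :=
(QG₁Q*)⁻¹` (3.132), `H₁` (3.129), `GG := 𝔊` (3.153); every other field — the transporters, `Gp ∕ GA ∕ C` with their printed `U = 1` clauses, `Kdiff`,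
`Ck`, `P349` — is kept (the law `Gp_one` pins `Gp` to the lattice `G♯`, so the record's OWN `G′` is never re-based; only the composites are re-fed).
[cite: Balaban1985BackgroundPropagators, (3.122)–(3.126) p.420, (3.128)–(3.129) p.421, (3.132) p.422, (3.153) p.426] -/
def CovLettersY.withSectDEAt (𝔏 : CovLettersY 𝔸 x) (Gp' : SiteOpY 𝔸 x.toKIdx) (Δ2 : BondOpY 𝔸 x.toKIdx) : CovLettersY 𝔸 x :=
  { 𝔏 with
    GD := GDY x.toKIdx 𝔏.parS 𝔏.parB Gp'
    QGQinv := QGQinvY x.toKIdx 𝔏.parS 𝔏.parB Gp'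
    H := HDY x.toKIdx 𝔏.parS 𝔏.parB Gp'
    G₁ := G1Y x.toKIdx 𝔏.parS 𝔏.parB Gp' Δ2
    QG1Qinv := QG1QinvY x.toKIdx 𝔏.parS 𝔏.parB Gp' Δ2
    H₁ := H1Y x.toKIdx 𝔏.parS 𝔏.parB Gp' Δ2
    GG := GGY x.toKIdx 𝔏.parS 𝔏.parB Gp' Δ2 }

variable (𝔏 : CovLettersY 𝔸 x) (Gp' : SiteOpY 𝔸 x.toKIdx) (Δ2 : BondOpY 𝔸 x.toKIdx)

/-- the re-fed `GD = G̃[G′]`. [cite: Balaban1985BackgroundPropagators, (3.122)–(3.123) p.420, bookkeeping] -/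
theorem CovLettersY.withSectDEAt_GD : (𝔏.withSectDEAt Gp' Δ2).GD = GDY x.toKIdx 𝔏.parS 𝔏.parB Gp' := rfl
/-- the re-fed `QGQinv = (QG̃Q*)⁻¹[G′]`. [cite: Balaban1985BackgroundPropagators, (3.132) p.422, bookkeeping] -/
theorem CovLettersY.withSectDEAt_QGQinv : (𝔏.withSectDEAt Gp' Δ2).QGQinv = QGQinvY x.toKIdx 𝔏.parS 𝔏.parB Gp' := rfl
/-- the re-fed `H = G̃Q*(QG̃Q*)⁻¹[G′]`. [cite: Balaban1985BackgroundPropagators, (3.126) p.420, bookkeeping] -/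
theorem CovLettersY.withSectDEAt_H : (𝔏.withSectDEAt Gp' Δ2).H = HDY x.toKIdx 𝔏.parS 𝔏.parB Gp' := rfl
/-- the re-fed `G₁[G′, Δ⁽²⁾]`. [cite: Balaban1985BackgroundPropagators, (3.128)–(3.129) p.421, bookkeeping] -/
theorem CovLettersY.withSectDEAt_G₁ : (𝔏.withSectDEAt Gp' Δ2).G₁ = G1Y x.toKIdx 𝔏.parS 𝔏.parB Gp' Δ2 := rfl
/-- the re-fed `QG1Qinv = (QG₁Q*)⁻¹[G′, Δ⁽²⁾]`. [cite: Balaban1985BackgroundPropagators, (3.132) p.422, bookkeeping] -/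
theorem CovLettersY.withSectDEAt_QG1Qinv : (𝔏.withSectDEAt Gp' Δ2).QG1Qinv = QG1QinvY x.toKIdx 𝔏.parS 𝔏.parB Gp' Δ2 := rfl
/-- the re-fed `H₁ = G₁Q*(QG₁Q*)⁻¹[G′, Δ⁽²⁾]`. [cite: Balaban1985BackgroundPropagators, (3.129) p.421, bookkeeping] -/
theorem CovLettersY.withSectDEAt_H₁ : (𝔏.withSectDEAt Gp' Δ2).H₁ = H1Y x.toKIdx 𝔏.parS 𝔏.parB Gp' Δ2 := rfl
/-- the re-fed `GG = 𝔊[G′, Δ⁽²⁾]`. [cite: Balaban1985BackgroundPropagators, (3.153) p.426, bookkeeping] -/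
theorem CovLettersY.withSectDEAt_GG : (𝔏.withSectDEAt Gp' Δ2).GG = GGY x.toKIdx 𝔏.parS 𝔏.parB Gp' Δ2 := rfl
/-- the update keeps the record's OWN `G′`. [cite: Balaban1985BackgroundPropagators, (3.25) p.394, bookkeeping] -/
theorem CovLettersY.withSectDEAt_Gp : (𝔏.withSectDEAt Gp' Δ2).Gp = 𝔏.Gp := rfl
/-- the update keeps `G = Δ_a⁻¹`. [cite: Balaban1985BackgroundPropagators, (3.27) p.395, bookkeeping] -/
theorem CovLettersY.withSectDEAt_GA : (𝔏.withSectDEAt Gp' Δ2).GA = 𝔏.GA := rfl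
/-- the update keeps `C`. [cite: Balaban1985BackgroundPropagators, (3.48) p.398, bookkeeping] -/
theorem CovLettersY.withSectDEAt_C : (𝔏.withSectDEAt Gp' Δ2).C = 𝔏.C := rfl
/-- the update keeps `Kdiff`. [cite: Balaban1985BackgroundPropagators, Thm 3.14 pp.426–427, bookkeeping] -/
theorem CovLettersY.withSectDEAt_Kdiff : (𝔏.withSectDEAt Gp' Δ2).Kdiff = 𝔏.Kdiff := rfl
/-- the update keeps the site transporter. [cite: Balaban1985BackgroundPropagators, (3.24) p.394, bookkeeping] -/
theorem CovLettersY.withSectDEAt_parS : (𝔏.withSectDEAt Gp' Δ2).parS = 𝔏.parS := rfl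
/-- the update keeps the bond transporter. [cite: Balaban1985BackgroundPropagators, (3.40) p.397, bookkeeping] -/
theorem CovLettersY.withSectDEAt_parB : (𝔏.withSectDEAt Gp' Δ2).parB = 𝔏.parB := rfl
/-- the update keeps the `P349` slot. [cite: Balaban1985BackgroundPropagators, (3.49) p.399, bookkeeping] -/
theorem CovLettersY.withSectDEAt_P349 : (𝔏.withSectDEAt Gp' Δ2).P349 = 𝔏.P349 := rfl
/-- the update keeps the `Ck` slot. [cite: Balaban1985BackgroundPropagators, (3.187) p.432, bookkeeping] -/
theorem CovLettersY.withSectDEAt_Ck : (𝔏.withSectDEAt Gp' Δ2).Ck = 𝔏.Ck := rfl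

/-- re-feeding the record's OWN `G′` (and the residual of a `withDE` update) reproduces `withSectD ∘ withDE` — the v3∕v4 construction is the
update at `Gp' := 𝔏.Gp`. [cite: Balaban1985BackgroundPropagators, (3.122)–(3.132) pp.420–422, (3.153) p.426, bookkeeping] -/
theorem CovLettersY.withSectDEAt_self (GA' : BondOpY 𝔸 x.toKIdx) (𝔯 : ResLettersY 𝔸 x) :
    (withSectD 𝔸 (𝔏.withDE 𝔸 GA' 𝔯)).withSectDEAt 𝔏.Gp 𝔯.Δ2 = withSectD 𝔸 (𝔏.withDE 𝔸 GA' 𝔯) := rfl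

end Updater

/-! ## §2 ★ The member family `covLettersY_v4P`: the v4 family with its Sect. D∕E composites fed `G′_phys = η²·G′_latt` -/

section Chain

variable (𝔸) (x : MemberY d ℓ hd hL b₀ b₁ Mstar)

/-- ★★ **def-Y's v4P FAMILY**: the v4 family `covLettersY_v4 𝔸 x 𝔯` (symmetrised transporters, `G′ = GpY`, `G = Δ_a⁻¹`, `C`, `G(Ω′)`, the flat
`P349 ∕ Ck` slots, the printed `U = 1` clauses) with its seven Sect. D∕E composites `G̃, (QG̃Q*)⁻¹, H, G₁, (QG₁Q*)⁻¹, H₁, 𝔊` RE-FED THE PRINT-UNITS SITE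
PROPAGATOR `G′_phys(U) = η²·G′_latt(U)` over the residual letter `𝔯.Δ2`.
[cite: Balaban1985BackgroundPropagators, (3.24)–(3.25) p.394, (3.26)–(3.27) p.395, (3.119) p.419, (3.122)–(3.132) pp.420–422, (3.153) p.426] -/
def covLettersY_v4P (𝔯 : ResLettersY 𝔸 x) : CovLettersY 𝔸 x :=
  (covLettersY_v4 𝔸 x 𝔯).withSectDEAt (GpPhysY x.toKIdx (parSymY x.toKIdx)) 𝔯.Δ2

variable {x}
variable (𝔯 : ResLettersY 𝔸 x)

/-- its `GD` is Sect. D's `G̃` FED `G′_phys`. [cite: Balaban1985BackgroundPropagators, (3.122)–(3.123) p.420, bookkeeping] -/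
theorem covLettersY_v4P_GD :
    (covLettersY_v4P 𝔸 x 𝔯).GD = GDY x.toKIdx (parSymY x.toKIdx) (parBY x.toKIdx) (GpPhysY x.toKIdx (parSymY x.toKIdx)) := rfl
/-- its `H` (3.126) fed `G′_phys`. [cite: Balaban1985BackgroundPropagators, (3.126) p.420, bookkeeping] -/
theorem covLettersY_v4P_H :
    (covLettersY_v4P 𝔸 x 𝔯).H = HDY x.toKIdx (parSymY x.toKIdx) (parBY x.toKIdx) (GpPhysY x.toKIdx (parSymY x.toKIdx)) := rfl
/-- its `QGQinv = (QG̃Q*)⁻¹` fed `G′_phys`. [cite: Balaban1985BackgroundPropagators, (3.132) p.422, bookkeeping] -/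
theorem covLettersY_v4P_QGQinv :
    (covLettersY_v4P 𝔸 x 𝔯).QGQinv = QGQinvY x.toKIdx (parSymY x.toKIdx) (parBY x.toKIdx) (GpPhysY x.toKIdx (parSymY x.toKIdx)) := rfl
/-- its `G₁` fed `G′_phys`. [cite: Balaban1985BackgroundPropagators, (3.128)–(3.129) p.421, bookkeeping] -/
theorem covLettersY_v4P_G₁ :
    (covLettersY_v4P 𝔸 x 𝔯).G₁ = G1Y x.toKIdx (parSymY x.toKIdx) (parBY x.toKIdx) (GpPhysY x.toKIdx (parSymY x.toKIdx)) 𝔯.Δ2 := rfl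
/-- its `H₁` fed `G′_phys`. [cite: Balaban1985BackgroundPropagators, (3.129) p.421, bookkeeping] -/
theorem covLettersY_v4P_H₁ :
    (covLettersY_v4P 𝔸 x 𝔯).H₁ = H1Y x.toKIdx (parSymY x.toKIdx) (parBY x.toKIdx) (GpPhysY x.toKIdx (parSymY x.toKIdx)) 𝔯.Δ2 := rfl
/-- its `QG1Qinv = (QG₁Q*)⁻¹` fed `G′_phys`. [cite: Balaban1985BackgroundPropagators, (3.132) p.422, bookkeeping] -/
theorem covLettersY_v4P_QG1Qinv :
    (covLettersY_v4P 𝔸 x 𝔯).QG1Qinv = QG1QinvY x.toKIdx (parSymY x.toKIdx) (parBY x.toKIdx) (GpPhysY x.toKIdx (parSymY x.toKIdx)) 𝔯.Δ2 := rfl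
/-- its `GG = 𝔊` fed `G′_phys`. [cite: Balaban1985BackgroundPropagators, (3.153) p.426, bookkeeping] -/
theorem covLettersY_v4P_GG :
    (covLettersY_v4P 𝔸 x 𝔯).GG = GGY x.toKIdx (parSymY x.toKIdx) (parBY x.toKIdx) (GpPhysY x.toKIdx (parSymY x.toKIdx)) 𝔯.Δ2 := rfl
/-- its `Kdiff` is v4's `G(Ω, U) − G(Ω′, U)` (Theorem 3.14's letter; `G` is blind to the units of `G′`). [cite: Balaban1985BackgroundPropagators, Thm 3.14 pp.426–427, bookkeeping] -/
theorem covLettersY_v4P_Kdiff : (covLettersY_v4P 𝔸 x 𝔯).Kdiff = KdiffSY 𝔸 x := rfl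
/-- its `G = Δ_a⁻¹` is v4's, over the lattice letter. [cite: Balaban1985BackgroundPropagators, (3.27) p.395, bookkeeping] -/
theorem covLettersY_v4P_GA :
    (covLettersY_v4P 𝔸 x 𝔯).GA = GAY x.toKIdx (parSymY x.toKIdx) (parBY x.toKIdx) (GpY x.toKIdx (parSymY x.toKIdx)) := rfl
/-- ★ … AND IT IS print's `G = Δ_a⁻¹` FED `G′_phys` too: `Δ_a` sees `G′` only through the degree-0 projection `R` (FILE 28 `GAY_GpPhysY`) — the Sect. B
letter and the Sect. D composites of the v4P family sit on ONE site propagator. [cite: Balaban1985BackgroundPropagators, (3.26)–(3.27) p.395, (3.25) p.394] -/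
theorem covLettersY_v4P_GA_phys :
    (covLettersY_v4P 𝔸 x 𝔯).GA = GAY x.toKIdx (parSymY x.toKIdx) (parBY x.toKIdx) (GpPhysY x.toKIdx (parSymY x.toKIdx)) :=
  (GAY_GpPhysY (parSymY x.toKIdx) (parBY x.toKIdx)).symm
/-- its `C = (Q′G′²Q′*)⁻¹` is v4's, over the lattice letter (its (3.48) reading weight `cWtY ∋ η⁻⁴` converts). [cite: Balaban1985BackgroundPropagators, (3.48) p.398, bookkeeping] -/
theorem covLettersY_v4P_C : (covLettersY_v4P 𝔸 x 𝔯).C = CY x.toKIdx (parSymY x.toKIdx) (GpY x.toKIdx (parSymY x.toKIdx)) := rfl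
/-- its OWN `G′` is the lattice letter `GpY` (pinned there by the printed `U = 1` law `Gp_one`; its (3.42) reading prefactors `η^(2,1,1,0)` convert).
[cite: Balaban1985BackgroundPropagators, (3.25) p.394, Cor. 3.5 p.407, bookkeeping] -/
theorem covLettersY_v4P_Gp : (covLettersY_v4P 𝔸 x 𝔯).Gp = GpY x.toKIdx (parSymY x.toKIdx) := rfl
/-- its site transporters are the symmetrised ones. [cite: Balaban1985BackgroundPropagators, (3.40) p.397, bookkeeping] -/
theorem covLettersY_v4P_parS : (covLettersY_v4P 𝔸 x 𝔯).parS = parSymY x.toKIdx := rfl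
/-- its bond transporters are the taxicab ones. [cite: Balaban1985BackgroundPropagators, (3.40) p.397, bookkeeping] -/
theorem covLettersY_v4P_parB : (covLettersY_v4P 𝔸 x 𝔯).parB = parBY x.toKIdx := rfl
/-- its block-sector `P349 ∕ Ck` slots are the flat `0` (the genuine readings live in the LAYER, §4). [cite: Balaban1985BackgroundPropagators, (3.49) p.399, (3.185) p.432, bookkeeping] -/
theorem covLettersY_v4P_P349_Ck : (covLettersY_v4P 𝔸 x 𝔯).P349 = (fun _ => 0) ∧ (covLettersY_v4P 𝔸 x 𝔯).Ck = (fun _ => 0) := ⟨rfl, rfl⟩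
/-- the Sect. B PINS of the v4P family (the hypotheses `hGpS`-type faces at generic letters consume). [cite: Balaban1985BackgroundPropagators, (3.25) p.394, (3.26)–(3.27) p.395, (3.48) p.398, bookkeeping] -/
theorem covLettersY_v4P_pins :
    (covLettersY_v4P 𝔸 x 𝔯).Gp = GpY x.toKIdx (covLettersY_v4P 𝔸 x 𝔯).parS ∧
      (covLettersY_v4P 𝔸 x 𝔯).GA = GAY x.toKIdx (covLettersY_v4P 𝔸 x 𝔯).parS (covLettersY_v4P 𝔸 x 𝔯).parB (covLettersY_v4P 𝔸 x 𝔯).Gp ∧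
      (covLettersY_v4P 𝔸 x 𝔯).C = CY x.toKIdx (covLettersY_v4P 𝔸 x 𝔯).parS (covLettersY_v4P 𝔸 x 𝔯).Gp := ⟨rfl, rfl, rfl⟩
/-- outside Sect. D∕E the v4P family IS the v4 family, field by field. [cite: Balaban1985BackgroundPropagators, (3.24)–(3.27) pp.394–395, (3.48) p.398, Thm 3.14 pp.426–427, bookkeeping] -/
theorem covLettersY_v4P_base :
    (covLettersY_v4P 𝔸 x 𝔯).parS = (covLettersY_v4 𝔸 x 𝔯).parS ∧ (covLettersY_v4P 𝔸 x 𝔯).parB = (covLettersY_v4 𝔸 x 𝔯).parB ∧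
      (covLettersY_v4P 𝔸 x 𝔯).Gp = (covLettersY_v4 𝔸 x 𝔯).Gp ∧ (covLettersY_v4P 𝔸 x 𝔯).GA = (covLettersY_v4 𝔸 x 𝔯).GA ∧
      (covLettersY_v4P 𝔸 x 𝔯).C = (covLettersY_v4 𝔸 x 𝔯).C ∧ (covLettersY_v4P 𝔸 x 𝔯).Kdiff = (covLettersY_v4 𝔸 x 𝔯).Kdiff ∧
      (covLettersY_v4P 𝔸 x 𝔯).P349 = (covLettersY_v4 𝔸 x 𝔯).P349 ∧ (covLettersY_v4P 𝔸 x 𝔯).Ck = (covLettersY_v4 𝔸 x 𝔯).Ck :=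
  ⟨rfl, rfl, rfl, rfl, rfl, rfl, rfl, rfl⟩
/-- `v4P = v4.withSectDEAt G′_phys Δ⁽²⁾`, by name. [cite: Balaban1985BackgroundPropagators, (3.122)–(3.132) pp.420–422, bookkeeping] -/
theorem covLettersY_v4P_eq : covLettersY_v4P 𝔸 x 𝔯 = (covLettersY_v4 𝔸 x 𝔯).withSectDEAt (GpPhysY x.toKIdx (parSymY x.toKIdx)) 𝔯.Δ2 := rfl
/-- … while re-feeding the LATTICE letter gives back v4 itself. [cite: Balaban1985BackgroundPropagators, (3.122)–(3.132) pp.420–422, bookkeeping] -/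
theorem covLettersY_v4_withSectDEAt_GpY : (covLettersY_v4 𝔸 x 𝔯).withSectDEAt (GpY x.toKIdx (parSymY x.toKIdx)) 𝔯.Δ2 = covLettersY_v4 𝔸 x 𝔯 :=
  rfl

/-- the two `(3.132)` letters of v4P are `Ring.inverse` of NAMED operators (the `hQ ∕ hQ₁ := fun _ _ => rfl` pins of the row-26 knit face
`B9Eq3132FacesAtLetters.s3132Nu_opsYSectE_of_step12`). [cite: Balaban1985BackgroundPropagators, (3.132) p.422, bookkeeping] -/
theorem covLettersY_v4P_QGQinv_QG1Qinv_ringInverse (U : CfgY 𝔸 x.toKIdx) :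
    (covLettersY_v4P 𝔸 x 𝔯).QGQinv U =
        Ring.inverse (QGQY x.toKIdx (parSymY x.toKIdx) (parBY x.toKIdx) (GpPhysY x.toKIdx (parSymY x.toKIdx)) U) ∧
      (covLettersY_v4P 𝔸 x 𝔯).QG1Qinv U =
        Ring.inverse (QGQOfY x.toKIdx (parBY x.toKIdx)
          (G1Y x.toKIdx (parSymY x.toKIdx) (parBY x.toKIdx) (GpPhysY x.toKIdx (parSymY x.toKIdx)) 𝔯.Δ2) U) :=
  ⟨rfl, rfl⟩

/-! ### The `U = 1` faces of the v4P family are v4's (`Δ_π(1) = Δ(1)` is blind to `G′`; FILE 28's transfer) -/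

/-- `G̃(1)` of v4P is v4's. [cite: Balaban1985BackgroundPropagators, (3.122) p.420, Cor. 3.5 p.407] -/
theorem covLettersY_v4P_GD_one : (covLettersY_v4P 𝔸 x 𝔯).GD (fun _ _ => 1) = (covLettersY_v4 𝔸 x 𝔯).GD (fun _ _ => 1) :=
  GDY_GpPhysY_one (parSymY x.toKIdx) (parBY x.toKIdx)
/-- `(QG̃Q*)⁻¹(1)` of v4P is v4's. [cite: Balaban1985BackgroundPropagators, (3.132) p.422, Cor. 3.5 p.407] -/
theorem covLettersY_v4P_QGQinv_one : (covLettersY_v4P 𝔸 x 𝔯).QGQinv (fun _ _ => 1) = (covLettersY_v4 𝔸 x 𝔯).QGQinv (fun _ _ => 1) :=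
  QGQinvY_GpPhysY_one (parSymY x.toKIdx) (parBY x.toKIdx)
/-- `H(1)` of v4P is v4's. [cite: Balaban1985BackgroundPropagators, (3.126) p.420, Cor. 3.5 p.407] -/
theorem covLettersY_v4P_H_one : (covLettersY_v4P 𝔸 x 𝔯).H (fun _ _ => 1) = (covLettersY_v4 𝔸 x 𝔯).H (fun _ _ => 1) :=
  HDY_GpPhysY_one (parSymY x.toKIdx) (parBY x.toKIdx)
/-- `G₁(1)` of v4P is v4's (`Δ⁽²⁾(1) = 0`). [cite: Balaban1985BackgroundPropagators, (3.128) p.421, Cor. 3.5 p.407] -/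
theorem covLettersY_v4P_G₁_one : (covLettersY_v4P 𝔸 x 𝔯).G₁ (fun _ _ => 1) = (covLettersY_v4 𝔸 x 𝔯).G₁ (fun _ _ => 1) :=
  G1Y_GpPhysY_one (parSymY x.toKIdx) (parBY x.toKIdx) 𝔯.Δ2_one 𝔯.Δ2_one
/-- `(QG₁Q*)⁻¹(1)` of v4P is v4's. [cite: Balaban1985BackgroundPropagators, (3.132) p.422, Cor. 3.5 p.407] -/
theorem covLettersY_v4P_QG1Qinv_one : (covLettersY_v4P 𝔸 x 𝔯).QG1Qinv (fun _ _ => 1) = (covLettersY_v4 𝔸 x 𝔯).QG1Qinv (fun _ _ => 1) :=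
  QG1QinvY_GpPhysY_one (parSymY x.toKIdx) (parBY x.toKIdx) 𝔯.Δ2_one 𝔯.Δ2_one
/-- `H₁(1)` of v4P is v4's. [cite: Balaban1985BackgroundPropagators, (3.129) p.421, Cor. 3.5 p.407] -/
theorem covLettersY_v4P_H₁_one : (covLettersY_v4P 𝔸 x 𝔯).H₁ (fun _ _ => 1) = (covLettersY_v4 𝔸 x 𝔯).H₁ (fun _ _ => 1) :=
  H1Y_GpPhysY_one (parSymY x.toKIdx) (parBY x.toKIdx) 𝔯.Δ2_one 𝔯.Δ2_one
/-- `𝔊(1)` of v4P is v4's. [cite: Balaban1985BackgroundPropagators, (3.153) p.426, Cor. 3.5 p.407] -/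
theorem covLettersY_v4P_GG_one : (covLettersY_v4P 𝔸 x 𝔯).GG (fun _ _ => 1) = (covLettersY_v4 𝔸 x 𝔯).GG (fun _ _ => 1) :=
  GGY_GpPhysY_one (parSymY x.toKIdx) (parBY x.toKIdx) 𝔯.Δ2_one 𝔯.Δ2_one

end Chain

/-! ## §2′ (3.33)–(3.34) for the v4P family: gauge covariance (`G′_phys` is covariant, FILE 28 `GpPhysY_isCovSiteOpY`) -/

section ChainCov

variable {x : MemberY d ℓ hd hL b₀ b₁ Mstar} (g : GaugeY 𝔸 x.toKIdx) (U : CfgY 𝔸 x.toKIdx)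

/-- ★★ **THE v4P LETTERS ARE GAUGE COVARIANT** for a covariant residual `Δ⁽²⁾` — `covLettersY_v4_cov` with the covariant `G′_phys` in the composites.
[cite: Balaban1985BackgroundPropagators, (3.33)–(3.34) p.396, (3.119)–(3.153) pp.419–426, Thm 3.14 pp.426–427] -/
theorem covLettersY_v4P_cov (𝔯 : ResLettersY 𝔸 x) (hΔ : IsCovBondOpY x.toKIdx 𝔯.Δ2) :
    Intw (conjY (gBondY x.toKIdx g)) (conjY (gBondY x.toKIdx g)) ((covLettersY_v4P 𝔸 x 𝔯).GD U) ((covLettersY_v4P 𝔸 x 𝔯).GD (gaugeY x.toKIdx g U)) ∧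
      Intw (conjY (gBondY x.toKIdx g)) (conjY (gBondY x.toKIdx g)) ((covLettersY_v4P 𝔸 x 𝔯).G₁ U) ((covLettersY_v4P 𝔸 x 𝔯).G₁ (gaugeY x.toKIdx g U)) ∧
      Intw (conjY (gBondY x.toKIdx g)) (conjY (gBondY x.toKIdx g)) ((covLettersY_v4P 𝔸 x 𝔯).GG U) ((covLettersY_v4P 𝔸 x 𝔯).GG (gaugeY x.toKIdx g U)) ∧
      Intw (conjY (gBondY x.toKIdx g)) (conjY (gBondY x.toKIdx g)) ((covLettersY_v4P 𝔸 x 𝔯).Kdiff U)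
        ((covLettersY_v4P 𝔸 x 𝔯).Kdiff (gaugeY x.toKIdx g U)) ∧
      Intw (conjY (gIBondY x.toKIdx g)) (conjY (gBondY x.toKIdx g)) ((covLettersY_v4P 𝔸 x 𝔯).H U) ((covLettersY_v4P 𝔸 x 𝔯).H (gaugeY x.toKIdx g U)) ∧
      Intw (conjY (gIBondY x.toKIdx g)) (conjY (gBondY x.toKIdx g)) ((covLettersY_v4P 𝔸 x 𝔯).H₁ U) ((covLettersY_v4P 𝔸 x 𝔯).H₁ (gaugeY x.toKIdx g U)) ∧
      Intw (conjY (gIBondY x.toKIdx g)) (conjY (gIBondY x.toKIdx g)) ((covLettersY_v4P 𝔸 x 𝔯).QGQinv U)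
        ((covLettersY_v4P 𝔸 x 𝔯).QGQinv (gaugeY x.toKIdx g U)) ∧
      Intw (conjY (gIBondY x.toKIdx g)) (conjY (gIBondY x.toKIdx g)) ((covLettersY_v4P 𝔸 x 𝔯).QG1Qinv U)
        ((covLettersY_v4P 𝔸 x 𝔯).QG1Qinv (gaugeY x.toKIdx g U)) :=
  have hS := parSymY_isGaugeLawS (𝔸 := 𝔸) x.toKIdx
  have hB := parBY_isGaugeLawB (𝔸 := 𝔸) x.toKIdx
  have hGp := GpPhysY_isCovSiteOpY hS
  ⟨GDY_cov hS hB hGp, G1Y_cov hS hB hGp hΔ, GGY_cov hS hB hGp hΔ, KdiffSY_cov g U, HDY_cov hS hB hGp, H1Y_cov hS hB hGp hΔ,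
    QGQinvY_cov hS hB hGp, QG1QinvY_cov hS hB hGp hΔ⟩

end ChainCov

/-! ## §3 Trace-symmetry at `G`-valued configurations with `G′_phys` in the composites (`𝔸 = M_N(ℂ)`), and the unit `QG₁Q*` -/

section Symm

open scoped Matrix.Norms.L2Operator

variable {N : ℕ} {S : Type} [Fintype S]

/-- the trace pairing is real-homogeneous in its right slot, for a real scalar in its `ℂ`-coerced form. [folklore] -/
private theorem trIP_coe_smul_right (w : S → ℝ) (r : ℝ) (Φ Ψ : S → Matrix (Fin N) (Fin N) ℂ) :
    trIP w Φ ((((r : ℝ) : ℂ)) • Ψ) = r * trIP w Φ Ψ := by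
  rw [trIP_eq_re_trace, trIP_eq_re_trace, Finset.mul_sum]
  refine Finset.sum_congr rfl fun s _ => ?_
  rw [Pi.smul_apply, Matrix.mul_smul, Matrix.trace_smul, smul_eq_mul, Complex.re_ofReal_mul]
  ring

/-- a REAL multiple of a trace-symmetric operator is trace-symmetric (the shape of `G′_phys = η²·G′_latt`). [cite: Balaban1985BackgroundPropagators, Thm 3.11 p.416 («symmetric»), (3.25) p.394, bookkeeping] -/
theorem isSymmTr_coe_real_smul (w : S → ℝ) (r : ℝ) {T : (S → Matrix (Fin N) (Fin N) ℂ) →ₗ[ℂ] (S → Matrix (Fin N) (Fin N) ℂ)} (hT : IsSymmTr w T) :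
    IsSymmTr w (((r : ℝ) : ℂ) • T) := by
  intro Φ Ψ
  rw [LinearMap.smul_apply, LinearMap.smul_apply, trIP_comm w, trIP_coe_smul_right, trIP_coe_smul_right, trIP_comm w, hT Φ Ψ]

variable {d ℓ : ℕ} {hd : 1 ≤ d + 1} {hL : Odd (ℓ + 1) ∧ 1 < ℓ + 1} {b₀ b₁ : ℝ}
variable (i : KIdx d ℓ hd hL b₀ b₁) {G : Subgroup (Matrix (Fin N) (Fin N) ℂ)ˣ}

/-- ★ **`G′_phys(U)` OVER THE SYMMETRISED TRANSPORTERS IS `trIP`-SYMMETRIC** at a `G`-valued configuration, `G ≤ U(N)` (`η²` times a symmetric operator).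
[cite: Balaban1985BackgroundPropagators, (3.24)–(3.25) p.394, (3.35) p.396] -/
theorem isSymmTr_GpPhysY_parSymY (hG : G ≤ B7Prop2Explicit.unitaryUnits (Matrix (Fin N) (Fin N) ℂ)) {U : CfgY (Matrix (Fin N) (Fin N) ℂ) i}
    (hU : ∀ μ x, U μ x ∈ G) : IsSymmTr (fun _ => (1 : ℝ)) (GpPhysY i (parSymY i) U) := by
  rw [GpPhysY_apply]
  exact isSymmTr_coe_real_smul _ _ (isSymmTr_GpY_parSymY i hG hU)

/-- `R[G′_phys](U) = R[G′_latt](U)` is symmetric at a `G`-valued configuration. [cite: Balaban1985BackgroundPropagators, (3.20) p.394, (3.25) p.394] -/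
theorem RY_GpPhysY_parSymY_isSymmTr (hG : G ≤ B7Prop2Explicit.unitaryUnits (Matrix (Fin N) (Fin N) ℂ)) {U : CfgY (Matrix (Fin N) (Fin N) ℂ) i}
    (hU : ∀ μ x, U μ x ∈ G) : IsSymmTr (fun _ => (1 : ℝ)) (RY i (parSymY i) (GpPhysY i (parSymY i)) U) := by
  rw [RY_GpPhysY]
  exact RY_parSymY_isSymmTr i hG hU

/-- ★★ **SECT. D's `G̃(U)` FED `G′_phys`, OVER def-Y's SYMMETRISED TABLES, IS SYMMETRIC** for every `G`-valued configuration, `G ≤ U(N)` (FILE 19's engine).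
[cite: Balaban1985BackgroundPropagators, (3.122)–(3.123) p.420, (3.35) p.396] -/
theorem GDY_GpPhysY_isSymmTr_parSymY (hG : G ≤ B7Prop2Explicit.unitaryUnits (Matrix (Fin N) (Fin N) ℂ)) {U : CfgY (Matrix (Fin N) (Fin N) ℂ) i}
    (hU : ∀ μ x, U μ x ∈ G) : IsSymmTr (fun _ => (1 : ℝ)) (GDY i (parSymY i) (parBY i) (GpPhysY i (parSymY i)) U) :=
  GDY_isSymmTr i (parSymY i) (parBY i) (GpPhysY i (parSymY i)) U hG hU (fun s s' => parBY_mem i hU s s') (isSymmTr_GpPhysY_parSymY i hG hU)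
    (RY_GpPhysY_parSymY_isSymmTr i hG hU)

/-- ★★ `G₁(U)` fed `G′_phys` over the symmetrised tables IS SYMMETRIC at a `G`-valued configuration, given a symmetric residual letter `Δ⁽²⁾(U)`.
[cite: Balaban1985BackgroundPropagators, (3.128)–(3.129) p.421, (3.35) p.396] -/
theorem G1Y_GpPhysY_isSymmTr_parSymY (hG : G ≤ B7Prop2Explicit.unitaryUnits (Matrix (Fin N) (Fin N) ℂ)) {U : CfgY (Matrix (Fin N) (Fin N) ℂ) i}
    (hU : ∀ μ x, U μ x ∈ G) (Δ2 : BondOpY (Matrix (Fin N) (Fin N) ℂ) i) (hΔ2 : IsSymmTr (fun _ => (1 : ℝ)) (Δ2 U)) :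
    IsSymmTr (fun _ => (1 : ℝ)) (G1Y i (parSymY i) (parBY i) (GpPhysY i (parSymY i)) Δ2 U) :=
  G1Y_isSymmTr i (parSymY i) (parBY i) (GpPhysY i (parSymY i)) Δ2 U hG hU (fun s s' => parBY_mem i hU s s') (isSymmTr_GpPhysY_parSymY i hG hU)
    (RY_GpPhysY_parSymY_isSymmTr i hG hU) hΔ2

/-- ★★ `𝔊(U)` (3.153) fed `G′_phys` over the symmetrised tables IS SYMMETRIC at a `G`-valued configuration, given a symmetric residual letter `Δ⁽²⁾(U)`.
[cite: Balaban1985BackgroundPropagators, (3.153) p.426, (3.35) p.396] -/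
theorem GGY_GpPhysY_isSymmTr_parSymY (hG : G ≤ B7Prop2Explicit.unitaryUnits (Matrix (Fin N) (Fin N) ℂ)) {U : CfgY (Matrix (Fin N) (Fin N) ℂ) i}
    (hU : ∀ μ x, U μ x ∈ G) (Δ2 : BondOpY (Matrix (Fin N) (Fin N) ℂ) i) (hΔ2 : IsSymmTr (fun _ => (1 : ℝ)) (Δ2 U)) :
    IsSymmTr (fun _ => (1 : ℝ)) (GGY i (parSymY i) (parBY i) (GpPhysY i (parSymY i)) Δ2 U) :=
  GGY_isSymmTr i (parSymY i) (parBY i) (GpPhysY i (parSymY i)) Δ2 U hG hU (fun s s' => parBY_mem i hU s s') (isSymmTr_GpPhysY_parSymY i hG hU)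
    (RY_GpPhysY_parSymY_isSymmTr i hG hU) hΔ2

/-- ★★★ **THE UNIT `QG₁Q*(U)` FROM `Δ⁽¹⁾(U) > 0` ALONE, WITH `G′_phys` IN THE COMPOSITES** — FILE 24's `isUnit_QGQOfY_G1Y_record_of_posDefTr` at the tables
`parSymY ∕ parBY ∕ GpPhysY (parSymY)` (the certificate's `hUQ` shape), `G`-valued configuration, `G ≤ U(N)`.
[cite: Balaban1985BackgroundPropagators, (3.132) p.422, (3.128) p.421, (3.138) p.423, (3.35) p.396] -/
theorem isUnit_QGQOfY_G1Y_recordP_of_posDefTr (hG : G ≤ B7Prop2Explicit.unitaryUnits (Matrix (Fin N) (Fin N) ℂ))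
    {U : CfgY (Matrix (Fin N) (Fin N) ℂ) i} (hU : ∀ μ x, U μ x ∈ G) (Δ2 : BondOpY (Matrix (Fin N) (Fin N) ℂ) i)
    (hΔ1 : PosDefTr (fun _ => (1 : ℝ)) (deltaOneY i (parSymY i) (parBY i) (GpPhysY i (parSymY i)) Δ2 U)) :
    IsUnit (QGQOfY i (parBY i) (G1Y i (parSymY i) (parBY i) (GpPhysY i (parSymY i)) Δ2) U) :=
  isUnit_QGQOfY_G1Y_of_posDefTr_deltaOneY i hG (parBY i) U (fun s s' => parBY_mem i hU s s') _ _ Δ2 hΔ1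

end Symm

/-! ## §4 ★★ AT THE RECORD: `lettersYOfRecordV4P`, its faces, and ★★★ the two instances `opsYOfRecordV4PE` ∕ `opsYNuOfRecordV4PE` -/

section Record

open scoped Matrix.Norms.L2Operator

/-- ★★ **THE v4P LETTERS OF RECORD**: the v4P family at every member of Stage 3′(Y), `𝔸 = M_N(ℂ)`, over a residual family `𝔯` — the v4 letters of record
with their Sect. D∕E composites fed `G′_phys = η²·G′_latt`.
[cite: Balaban1985BackgroundPropagators, (3.19) p.393, (3.24)–(3.25) p.394, (3.26)–(3.27) p.395, (3.48) p.398, (3.119) p.419, (3.122)–(3.132) pp.420–422, (3.153) p.426, Thm 3.14 pp.426–427] -/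
def lettersYOfRecordV4P (N : ℕ) (θ : Stage3Params) (Mstar : ℕ) (𝔯 : ResY N θ Mstar) : LettersY N θ Mstar :=
  fun x => covLettersY_v4P (Matrix (Fin N) (Fin N) ℂ) x (𝔯 x)

/-- ★★★ **THE v4P INSTANCE OF RECORD** of Stage 3′(Y): def-Y's Sect.-E constructor `opsYSectE` over dag-n06-i's site-(3.49) layer, BOTH at the v4P letters
(`opsYOfRecordV4E` with the Sect. D∕E composites fed `G′_phys`). [cite: Balaban1985BackgroundPropagators, Thms 3.1–3.15 pp.397–432] -/
def opsYOfRecordV4PE (N : ℕ) (θ : Stage3Params) (Mstar : ℕ) (𝔯 : ResY N θ Mstar) (𝔢 : SectEY N θ Mstar) (𝔴 : RWEY N θ Mstar)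
    (𝔈 : ExpsY N θ Mstar) : OpsY N θ Mstar :=
  opsYSectE N θ Mstar (opsYS349OfLetters N θ Mstar (lettersYOfRecordV4P N θ Mstar 𝔯) 𝔈) (lettersYOfRecordV4P N θ Mstar 𝔯) 𝔢 𝔴

/-- ★★★ **THE v4P INSTANCE OF RECORD WITH ROW 26 `ν`-READ**: `opsYSectE … (opsYS349NuOfLetters … 𝔏⁺ 𝔈) 𝔏⁺ 𝔢 𝔴` at `𝔏⁺ := lettersYOfRecordV4P …` —
dag-n06-i's `opsYNuOfRecordV4E` with the Sect. D∕E composites fed `G′_phys`; exactly the shape `B9Eq3132FacesAtLetters.s3132Nu_opsYSectE_of_step12` consumes.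
[cite: Balaban1985BackgroundPropagators, Thms 3.1–3.15 pp.397–432, (3.132) p.422] -/
def opsYNuOfRecordV4PE (N : ℕ) (θ : Stage3Params) (Mstar : ℕ) (𝔯 : ResY N θ Mstar) (𝔢 : SectEY N θ Mstar) (𝔴 : RWEY N θ Mstar)
    (𝔈 : ExpsY N θ Mstar) : OpsY N θ Mstar :=
  opsYSectE N θ Mstar (opsYS349NuOfLetters N θ Mstar (lettersYOfRecordV4P N θ Mstar 𝔯) 𝔈) (lettersYOfRecordV4P N θ Mstar 𝔯) 𝔢 𝔴

variable (N : ℕ) (θ : Stage3Params) (Mstar : ℕ) (𝔯 : ResY N θ Mstar) (𝔢 : SectEY N θ Mstar) (𝔴 : RWEY N θ Mstar) (𝔈 : ExpsY N θ Mstar)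

/-- the v4P letters of record at a member are the v4P family. [cite: Balaban1985BackgroundPropagators, (3.122)–(3.132) pp.420–422, bookkeeping] -/
theorem lettersYOfRecordV4P_apply (x : MemberY θ.d₆ θ.ℓ₆ θ.hd' θ.hL' θ.b₀ θ.b₁ Mstar) :
    lettersYOfRecordV4P N θ Mstar 𝔯 x = covLettersY_v4P (Matrix (Fin N) (Fin N) ℂ) x (𝔯 x) := rfl

/-- the v4P record's site transporter is the symmetrised one. [cite: Balaban1985BackgroundPropagators, (3.24) p.394, (3.40) p.397, bookkeeping] -/
theorem lettersYOfRecordV4P_parS (x : MemberY θ.d₆ θ.ℓ₆ θ.hd' θ.hL' θ.b₀ θ.b₁ Mstar) : (lettersYOfRecordV4P N θ Mstar 𝔯 x).parS = parSymY x.toKIdx :=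
  rfl

/-- the v4P record's bond transporter is the taxicab one. [cite: Balaban1985BackgroundPropagators, (3.40) p.397, bookkeeping] -/
theorem lettersYOfRecordV4P_parB (x : MemberY θ.d₆ θ.ℓ₆ θ.hd' θ.hL' θ.b₀ θ.b₁ Mstar) : (lettersYOfRecordV4P N θ Mstar 𝔯 x).parB = parBY x.toKIdx :=
  rfl

/-- the v4P record's OWN `G′` is the lattice letter (row 18's (3.42) reading and the site pins `hGpS` are v4's VERBATIM).
[cite: Balaban1985BackgroundPropagators, (3.25) p.394, bookkeeping] -/
theorem lettersYOfRecordV4P_Gp (x : MemberY θ.d₆ θ.ℓ₆ θ.hd' θ.hL' θ.b₀ θ.b₁ Mstar) :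
    (lettersYOfRecordV4P N θ Mstar 𝔯 x).Gp = GpY x.toKIdx (parSymY x.toKIdx) := rfl

/-- the Sect. B letters of the v4P record, by name (v4's). [cite: Balaban1985BackgroundPropagators, (3.25) p.394, (3.26)–(3.27) p.395, (3.48) p.398, bookkeeping] -/
theorem lettersYOfRecordV4P_sectB (x : MemberY θ.d₆ θ.ℓ₆ θ.hd' θ.hL' θ.b₀ θ.b₁ Mstar) :
    (lettersYOfRecordV4P N θ Mstar 𝔯 x).parS = parSymY x.toKIdx ∧ (lettersYOfRecordV4P N θ Mstar 𝔯 x).parB = parBY x.toKIdx ∧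
      (lettersYOfRecordV4P N θ Mstar 𝔯 x).Gp = GpY x.toKIdx (parSymY x.toKIdx) ∧
      (lettersYOfRecordV4P N θ Mstar 𝔯 x).GA = GAv4Y (Matrix (Fin N) (Fin N) ℂ) x.toKIdx ∧
      (lettersYOfRecordV4P N θ Mstar 𝔯 x).C = CY x.toKIdx (parSymY x.toKIdx) (GpY x.toKIdx (parSymY x.toKIdx)) := ⟨rfl, rfl, rfl, rfl, rfl⟩

/-- the PINS of the v4P record (`Gp = GpY _ parS`, `GA = GAY _ parS parB Gp`, `C = CY _ parS Gp`). [cite: Balaban1985BackgroundPropagators, (3.25) p.394, (3.26)–(3.27) p.395, (3.48) p.398, bookkeeping] -/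
theorem lettersYOfRecordV4P_pins (x : MemberY θ.d₆ θ.ℓ₆ θ.hd' θ.hL' θ.b₀ θ.b₁ Mstar) :
    (lettersYOfRecordV4P N θ Mstar 𝔯 x).Gp = GpY x.toKIdx (lettersYOfRecordV4P N θ Mstar 𝔯 x).parS ∧
      (lettersYOfRecordV4P N θ Mstar 𝔯 x).GA =
        GAY x.toKIdx (lettersYOfRecordV4P N θ Mstar 𝔯 x).parS (lettersYOfRecordV4P N θ Mstar 𝔯 x).parB (lettersYOfRecordV4P N θ Mstar 𝔯 x).Gp ∧
      (lettersYOfRecordV4P N θ Mstar 𝔯 x).C = CY x.toKIdx (lettersYOfRecordV4P N θ Mstar 𝔯 x).parS (lettersYOfRecordV4P N θ Mstar 𝔯 x).Gp :=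
  ⟨rfl, rfl, rfl⟩

/-- ★ the Sect. D∕E letters of the v4P record, by name: THE COMPOSITES FED `G′_phys` (the certificate's `hGco12 ∕ hG1co12 ∕ hGGco12 ∕ hHm12 ∕ hH1m12 ∕ hQ ∕ hQ₁`
pins at the new record name these right-hand sides). [cite: Balaban1985BackgroundPropagators, (3.122)–(3.132) pp.420–422, (3.153) p.426, Thm 3.14 pp.426–427, bookkeeping] -/
theorem lettersYOfRecordV4P_sectDE (x : MemberY θ.d₆ θ.ℓ₆ θ.hd' θ.hL' θ.b₀ θ.b₁ Mstar) :
    (lettersYOfRecordV4P N θ Mstar 𝔯 x).GD = GDY x.toKIdx (parSymY x.toKIdx) (parBY x.toKIdx) (GpPhysY x.toKIdx (parSymY x.toKIdx)) ∧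
      (lettersYOfRecordV4P N θ Mstar 𝔯 x).QGQinv = QGQinvY x.toKIdx (parSymY x.toKIdx) (parBY x.toKIdx) (GpPhysY x.toKIdx (parSymY x.toKIdx)) ∧
      (lettersYOfRecordV4P N θ Mstar 𝔯 x).H = HDY x.toKIdx (parSymY x.toKIdx) (parBY x.toKIdx) (GpPhysY x.toKIdx (parSymY x.toKIdx)) ∧
      (lettersYOfRecordV4P N θ Mstar 𝔯 x).G₁ =
        G1Y x.toKIdx (parSymY x.toKIdx) (parBY x.toKIdx) (GpPhysY x.toKIdx (parSymY x.toKIdx)) (𝔯 x).Δ2 ∧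
      (lettersYOfRecordV4P N θ Mstar 𝔯 x).QG1Qinv =
        QG1QinvY x.toKIdx (parSymY x.toKIdx) (parBY x.toKIdx) (GpPhysY x.toKIdx (parSymY x.toKIdx)) (𝔯 x).Δ2 ∧
      (lettersYOfRecordV4P N θ Mstar 𝔯 x).H₁ =
        H1Y x.toKIdx (parSymY x.toKIdx) (parBY x.toKIdx) (GpPhysY x.toKIdx (parSymY x.toKIdx)) (𝔯 x).Δ2 ∧
      (lettersYOfRecordV4P N θ Mstar 𝔯 x).GG =
        GGY x.toKIdx (parSymY x.toKIdx) (parBY x.toKIdx) (GpPhysY x.toKIdx (parSymY x.toKIdx)) (𝔯 x).Δ2 ∧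
      (lettersYOfRecordV4P N θ Mstar 𝔯 x).Kdiff = KdiffSY (Matrix (Fin N) (Fin N) ℂ) x := ⟨rfl, rfl, rfl, rfl, rfl, rfl, rfl, rfl⟩

/-- ★ the v4P record's `G = Δ_a⁻¹` is ALSO the composite fed `G′_phys` (one site propagator behind Sect. B and Sect. D).
[cite: Balaban1985BackgroundPropagators, (3.26)–(3.27) p.395, (3.25) p.394] -/
theorem lettersYOfRecordV4P_GA_phys (x : MemberY θ.d₆ θ.ℓ₆ θ.hd' θ.hL' θ.b₀ θ.b₁ Mstar) :
    (lettersYOfRecordV4P N θ Mstar 𝔯 x).GA = GAY x.toKIdx (parSymY x.toKIdx) (parBY x.toKIdx) (GpPhysY x.toKIdx (parSymY x.toKIdx)) :=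
  covLettersY_v4P_GA_phys (Matrix (Fin N) (Fin N) ℂ) (𝔯 x)

/-- outside Sect. D∕E the v4P record IS the v4 record, field by field (rows 4–12, 17–19, 22–23 read v4's letters verbatim).
[cite: Balaban1985BackgroundPropagators, (3.24)–(3.27) pp.394–395, (3.48) p.398, Thm 3.14 pp.426–427, bookkeeping] -/
theorem lettersYOfRecordV4P_base (x : MemberY θ.d₆ θ.ℓ₆ θ.hd' θ.hL' θ.b₀ θ.b₁ Mstar) :
    (lettersYOfRecordV4P N θ Mstar 𝔯 x).parS = (lettersYOfRecordV4 N θ Mstar 𝔯 x).parS ∧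
      (lettersYOfRecordV4P N θ Mstar 𝔯 x).parB = (lettersYOfRecordV4 N θ Mstar 𝔯 x).parB ∧
      (lettersYOfRecordV4P N θ Mstar 𝔯 x).Gp = (lettersYOfRecordV4 N θ Mstar 𝔯 x).Gp ∧
      (lettersYOfRecordV4P N θ Mstar 𝔯 x).GA = (lettersYOfRecordV4 N θ Mstar 𝔯 x).GA ∧
      (lettersYOfRecordV4P N θ Mstar 𝔯 x).C = (lettersYOfRecordV4 N θ Mstar 𝔯 x).C ∧
      (lettersYOfRecordV4P N θ Mstar 𝔯 x).Kdiff = (lettersYOfRecordV4 N θ Mstar 𝔯 x).Kdiff ∧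
      (lettersYOfRecordV4P N θ Mstar 𝔯 x).P349 = (lettersYOfRecordV4 N θ Mstar 𝔯 x).P349 ∧
      (lettersYOfRecordV4P N θ Mstar 𝔯 x).Ck = (lettersYOfRecordV4 N θ Mstar 𝔯 x).Ck := ⟨rfl, rfl, rfl, rfl, rfl, rfl, rfl, rfl⟩

/-- the v4P record IS the v4 record updated by `withSectDEAt G′_phys`, member by member. [cite: Balaban1985BackgroundPropagators, (3.122)–(3.132) pp.420–422, bookkeeping] -/
theorem lettersYOfRecordV4P_eq_withSectDEAt (x : MemberY θ.d₆ θ.ℓ₆ θ.hd' θ.hL' θ.b₀ θ.b₁ Mstar) :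
    lettersYOfRecordV4P N θ Mstar 𝔯 x = (lettersYOfRecordV4 N θ Mstar 𝔯 x).withSectDEAt (GpPhysY x.toKIdx (parSymY x.toKIdx)) (𝔯 x).Δ2 := rfl

/-- the seven `U = 1` faces of the v4P record are the v4 record's. [cite: Balaban1985BackgroundPropagators, (3.122)–(3.132) pp.420–422, (3.153) p.426, Cor. 3.5 p.407] -/
theorem lettersYOfRecordV4P_one (x : MemberY θ.d₆ θ.ℓ₆ θ.hd' θ.hL' θ.b₀ θ.b₁ Mstar) :
    (lettersYOfRecordV4P N θ Mstar 𝔯 x).GD (fun _ _ => 1) = (lettersYOfRecordV4 N θ Mstar 𝔯 x).GD (fun _ _ => 1) ∧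
      (lettersYOfRecordV4P N θ Mstar 𝔯 x).QGQinv (fun _ _ => 1) = (lettersYOfRecordV4 N θ Mstar 𝔯 x).QGQinv (fun _ _ => 1) ∧
      (lettersYOfRecordV4P N θ Mstar 𝔯 x).H (fun _ _ => 1) = (lettersYOfRecordV4 N θ Mstar 𝔯 x).H (fun _ _ => 1) ∧
      (lettersYOfRecordV4P N θ Mstar 𝔯 x).G₁ (fun _ _ => 1) = (lettersYOfRecordV4 N θ Mstar 𝔯 x).G₁ (fun _ _ => 1) ∧
      (lettersYOfRecordV4P N θ Mstar 𝔯 x).QG1Qinv (fun _ _ => 1) = (lettersYOfRecordV4 N θ Mstar 𝔯 x).QG1Qinv (fun _ _ => 1) ∧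
      (lettersYOfRecordV4P N θ Mstar 𝔯 x).H₁ (fun _ _ => 1) = (lettersYOfRecordV4 N θ Mstar 𝔯 x).H₁ (fun _ _ => 1) ∧
      (lettersYOfRecordV4P N θ Mstar 𝔯 x).GG (fun _ _ => 1) = (lettersYOfRecordV4 N θ Mstar 𝔯 x).GG (fun _ _ => 1) :=
  ⟨covLettersY_v4P_GD_one _ (𝔯 x), covLettersY_v4P_QGQinv_one _ (𝔯 x), covLettersY_v4P_H_one _ (𝔯 x), covLettersY_v4P_G₁_one _ (𝔯 x),
    covLettersY_v4P_QG1Qinv_one _ (𝔯 x), covLettersY_v4P_H₁_one _ (𝔯 x), covLettersY_v4P_GG_one _ (𝔯 x)⟩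

/-- ★ at `U = 1` the v4P record's `G₁` acts on product-form arguments as the lift of `Gop` (`lettersYOfRecordV4_G₁_one`, transferred).
[cite: Balaban1985BackgroundPropagators, Cor. 3.5 p.407, (3.129) p.421] -/
theorem lettersYOfRecordV4P_G₁_one (x : MemberY θ.d₆ θ.ℓ₆ θ.hd' θ.hL' θ.b₀ θ.b₁ Mstar) (J : FBondY x.toKIdx → ℝ) (E : Matrix (Fin N) (Fin N) ℂ) :
    (lettersYOfRecordV4P N θ Mstar 𝔯 x).G₁ (fun _ _ => 1) (liftY J E) = liftY (B6Prop26Census2136KLevelV1.Gop x.toKIdx J) E := by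
  rw [(lettersYOfRecordV4P_one N θ Mstar 𝔯 x).2.2.2.1]
  exact lettersYOfRecordV4_G₁_one N θ Mstar 𝔯 x J E

variable {G : Subgroup (Matrix (Fin N) (Fin N) ℂ)ˣ}

/-- ★★★ **THE v4P RECORD'S `GD` IS SYMMETRIC** at every `G`-valued configuration, `G ≤ U(N)` — no residual hypothesis.
[cite: Balaban1985BackgroundPropagators, (3.122)–(3.123) p.420, (3.35) p.396] -/
theorem lettersYOfRecordV4P_GD_isSymmTr (hG : G ≤ B7Prop2Explicit.unitaryUnits (Matrix (Fin N) (Fin N) ℂ))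
    (x : MemberY θ.d₆ θ.ℓ₆ θ.hd' θ.hL' θ.b₀ θ.b₁ Mstar) {U : CfgY (Matrix (Fin N) (Fin N) ℂ) x.toKIdx} (hU : ∀ μ z, U μ z ∈ G) :
    IsSymmTr (fun _ => (1 : ℝ)) ((lettersYOfRecordV4P N θ Mstar 𝔯 x).GD U) :=
  GDY_GpPhysY_isSymmTr_parSymY x.toKIdx hG hU

/-- ★★ **THE v4P RECORD'S `G₁` IS SYMMETRIC** at every `G`-valued configuration at which the residual letter `(𝔯 x).Δ2` is.
[cite: Balaban1985BackgroundPropagators, (3.128)–(3.129) p.421, (3.35) p.396] -/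
theorem lettersYOfRecordV4P_G₁_isSymmTr (hG : G ≤ B7Prop2Explicit.unitaryUnits (Matrix (Fin N) (Fin N) ℂ))
    (x : MemberY θ.d₆ θ.ℓ₆ θ.hd' θ.hL' θ.b₀ θ.b₁ Mstar) {U : CfgY (Matrix (Fin N) (Fin N) ℂ) x.toKIdx} (hU : ∀ μ z, U μ z ∈ G)
    (hΔ2 : IsSymmTr (fun _ => (1 : ℝ)) ((𝔯 x).Δ2 U)) : IsSymmTr (fun _ => (1 : ℝ)) ((lettersYOfRecordV4P N θ Mstar 𝔯 x).G₁ U) :=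
  G1Y_GpPhysY_isSymmTr_parSymY x.toKIdx hG hU (𝔯 x).Δ2 hΔ2

/-- ★★ **THE v4P RECORD'S `GG = 𝔊` IS SYMMETRIC** at every `G`-valued configuration at which the residual letter `(𝔯 x).Δ2` is.
[cite: Balaban1985BackgroundPropagators, (3.153) p.426, (3.35) p.396] -/
theorem lettersYOfRecordV4P_GG_isSymmTr (hG : G ≤ B7Prop2Explicit.unitaryUnits (Matrix (Fin N) (Fin N) ℂ))
    (x : MemberY θ.d₆ θ.ℓ₆ θ.hd' θ.hL' θ.b₀ θ.b₁ Mstar) {U : CfgY (Matrix (Fin N) (Fin N) ℂ) x.toKIdx} (hU : ∀ μ z, U μ z ∈ G)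
    (hΔ2 : IsSymmTr (fun _ => (1 : ℝ)) ((𝔯 x).Δ2 U)) : IsSymmTr (fun _ => (1 : ℝ)) ((lettersYOfRecordV4P N θ Mstar 𝔯 x).GG U) :=
  GGY_GpPhysY_isSymmTr_parSymY x.toKIdx hG hU (𝔯 x).Δ2 hΔ2

/-- ★★★ **THE CERTIFICATE's `hsymD` AT THE v4P RECORD** (`GD ∧ G₁ ∧ GG`, special-unitary configurations) from the one displayed hypothesis on the residual
PARAMETER `𝔯` — `lettersYOfRecordV4_symmDG₁GG` with `G′_phys` in the composites.
[cite: Balaban1985BackgroundPropagators, (3.122) p.420, (3.128) p.421, (3.153) p.426, (3.35) p.396] -/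
theorem lettersYOfRecordV4P_symmDG₁GG
    (hΔ2 : ∀ (x : MemberY θ.d₆ θ.ℓ₆ θ.hd' θ.hL' θ.b₀ θ.b₁ Mstar) (U : CfgY (Matrix (Fin N) (Fin N) ℂ) x.toKIdx), (∀ μ z, U μ z ∈ specialUnitaryUnits (Fin N)) →
      IsSymmTr (fun _ => (1 : ℝ)) ((𝔯 x).Δ2 U)) :
    ∀ (x : MemberY θ.d₆ θ.ℓ₆ θ.hd' θ.hL' θ.b₀ θ.b₁ Mstar) (U : CfgY (Matrix (Fin N) (Fin N) ℂ) x.toKIdx), (∀ μ z, U μ z ∈ specialUnitaryUnits (Fin N)) →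
      IsSymmTr (fun _ => (1 : ℝ)) ((lettersYOfRecordV4P N θ Mstar 𝔯 x).GD U) ∧ IsSymmTr (fun _ => (1 : ℝ)) ((lettersYOfRecordV4P N θ Mstar 𝔯 x).G₁ U) ∧
        IsSymmTr (fun _ => (1 : ℝ)) ((lettersYOfRecordV4P N θ Mstar 𝔯 x).GG U) :=
  fun x U hU => ⟨lettersYOfRecordV4P_GD_isSymmTr N θ Mstar 𝔯 specialUnitaryUnits_le_unitaryUnits x hU,
    lettersYOfRecordV4P_G₁_isSymmTr N θ Mstar 𝔯 specialUnitaryUnits_le_unitaryUnits x hU (hΔ2 x U hU),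
    lettersYOfRecordV4P_GG_isSymmTr N θ Mstar 𝔯 specialUnitaryUnits_le_unitaryUnits x hU (hΔ2 x U hU)⟩

/-- ★ at the FLAT residual family `resY_flat` the three symmetries are UNCONDITIONAL. [cite: Balaban1985BackgroundPropagators, (3.122) p.420, (3.128) p.421, (3.153) p.426, bookkeeping] -/
theorem lettersYOfRecordV4P_flat_symmDG₁GG :
    ∀ (x : MemberY θ.d₆ θ.ℓ₆ θ.hd' θ.hL' θ.b₀ θ.b₁ Mstar) (U : CfgY (Matrix (Fin N) (Fin N) ℂ) x.toKIdx), (∀ μ z, U μ z ∈ specialUnitaryUnits (Fin N)) →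
      IsSymmTr (fun _ => (1 : ℝ)) ((lettersYOfRecordV4P N θ Mstar (resY_flat N θ Mstar) x).GD U) ∧
        IsSymmTr (fun _ => (1 : ℝ)) ((lettersYOfRecordV4P N θ Mstar (resY_flat N θ Mstar) x).G₁ U) ∧
          IsSymmTr (fun _ => (1 : ℝ)) ((lettersYOfRecordV4P N θ Mstar (resY_flat N θ Mstar) x).GG U) :=
  lettersYOfRecordV4P_symmDG₁GG N θ Mstar (resY_flat N θ Mstar) fun x U _ => resY_flat_Δ2_isSymmTr θ Mstar x U

/-- ★★ **THE v4P LETTERS OF RECORD ARE GAUGE COVARIANT** at every member, for a covariant residual family (Sect. D∕E letters).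
[cite: Balaban1985BackgroundPropagators, (3.33)–(3.34) p.396, (3.119)–(3.153) pp.419–426, Thm 3.14 pp.426–427] -/
theorem lettersYOfRecordV4P_cov (x : MemberY θ.d₆ θ.ℓ₆ θ.hd' θ.hL' θ.b₀ θ.b₁ Mstar) (hΔ : IsCovBondOpY x.toKIdx (𝔯 x).Δ2)
    (g : GaugeY (Matrix (Fin N) (Fin N) ℂ) x.toKIdx) (U : CfgY (Matrix (Fin N) (Fin N) ℂ) x.toKIdx) :
    Intw (conjY (gBondY x.toKIdx g)) (conjY (gBondY x.toKIdx g)) ((lettersYOfRecordV4P N θ Mstar 𝔯 x).GD U)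
        ((lettersYOfRecordV4P N θ Mstar 𝔯 x).GD (gaugeY x.toKIdx g U)) ∧
      Intw (conjY (gBondY x.toKIdx g)) (conjY (gBondY x.toKIdx g)) ((lettersYOfRecordV4P N θ Mstar 𝔯 x).G₁ U)
        ((lettersYOfRecordV4P N θ Mstar 𝔯 x).G₁ (gaugeY x.toKIdx g U)) ∧
      Intw (conjY (gBondY x.toKIdx g)) (conjY (gBondY x.toKIdx g)) ((lettersYOfRecordV4P N θ Mstar 𝔯 x).GG U)
        ((lettersYOfRecordV4P N θ Mstar 𝔯 x).GG (gaugeY x.toKIdx g U)) ∧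
      Intw (conjY (gBondY x.toKIdx g)) (conjY (gBondY x.toKIdx g)) ((lettersYOfRecordV4P N θ Mstar 𝔯 x).Kdiff U)
        ((lettersYOfRecordV4P N θ Mstar 𝔯 x).Kdiff (gaugeY x.toKIdx g U)) ∧
      Intw (conjY (gIBondY x.toKIdx g)) (conjY (gBondY x.toKIdx g)) ((lettersYOfRecordV4P N θ Mstar 𝔯 x).H U)
        ((lettersYOfRecordV4P N θ Mstar 𝔯 x).H (gaugeY x.toKIdx g U)) ∧
      Intw (conjY (gIBondY x.toKIdx g)) (conjY (gBondY x.toKIdx g)) ((lettersYOfRecordV4P N θ Mstar 𝔯 x).H₁ U)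
        ((lettersYOfRecordV4P N θ Mstar 𝔯 x).H₁ (gaugeY x.toKIdx g U)) ∧
      Intw (conjY (gIBondY x.toKIdx g)) (conjY (gIBondY x.toKIdx g)) ((lettersYOfRecordV4P N θ Mstar 𝔯 x).QGQinv U)
        ((lettersYOfRecordV4P N θ Mstar 𝔯 x).QGQinv (gaugeY x.toKIdx g U)) ∧
      Intw (conjY (gIBondY x.toKIdx g)) (conjY (gIBondY x.toKIdx g)) ((lettersYOfRecordV4P N θ Mstar 𝔯 x).QG1Qinv U)
        ((lettersYOfRecordV4P N θ Mstar 𝔯 x).QG1Qinv (gaugeY x.toKIdx g U)) :=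
  covLettersY_v4P_cov g U (𝔯 x) hΔ

/-- ★ **THE UNIT `QG₁Q*(U)` AT THE v4P RECORD** from `Δ⁽¹⁾(U) > 0` (the certificate's `hUQ` at the new record, special-unitary configurations).
[cite: Balaban1985BackgroundPropagators, (3.132) p.422, (3.128) p.421, (3.138) p.423] -/
theorem lettersYOfRecordV4P_isUnit_QGQOfY_G₁ (x : MemberY θ.d₆ θ.ℓ₆ θ.hd' θ.hL' θ.b₀ θ.b₁ Mstar) {U : CfgY (Matrix (Fin N) (Fin N) ℂ) x.toKIdx}
    (hU : ∀ μ z, U μ z ∈ specialUnitaryUnits (Fin N))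
    (hΔ1 : PosDefTr (fun _ => (1 : ℝ)) (deltaOneY x.toKIdx (parSymY x.toKIdx) (parBY x.toKIdx) (GpPhysY x.toKIdx (parSymY x.toKIdx)) (𝔯 x).Δ2 U)) :
    IsUnit (QGQOfY x.toKIdx (parBY x.toKIdx) (lettersYOfRecordV4P N θ Mstar 𝔯 x).G₁ U) :=
  isUnit_QGQOfY_G1Y_recordP_of_posDefTr x.toKIdx specialUnitaryUnits_le_unitaryUnits hU (𝔯 x).Δ2 hΔ1

/-! ### The two instances, unfolded field by field (`rfl` transport for the certificate's rows) -/

/-- the v4P instance of record at a member, unfolded. [cite: Balaban1985BackgroundPropagators, Thm 3.15 p.432, bookkeeping] -/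
theorem opsYOfRecordV4PE_apply (x : MemberY θ.d₆ θ.ℓ₆ θ.hd' θ.hL' θ.b₀ θ.b₁ Mstar) :
    opsYOfRecordV4PE N θ Mstar 𝔯 𝔢 𝔴 𝔈 x =
      operatorLayerYSectE (Matrix (Fin N) (Fin N) ℂ) (specialUnitaryUnits (Fin N)) x
        (opsYS349OfLetters N θ Mstar (lettersYOfRecordV4P N θ Mstar 𝔯) 𝔈 x) (lettersYOfRecordV4P N θ Mstar 𝔯 x) (𝔢 x) (𝔴 x) := rfl

/-- the `ν`-read v4P instance of record at a member, unfolded. [cite: Balaban1985BackgroundPropagators, Thm 3.15 p.432, (3.132) p.422, bookkeeping] -/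
theorem opsYNuOfRecordV4PE_apply (x : MemberY θ.d₆ θ.ℓ₆ θ.hd' θ.hL' θ.b₀ θ.b₁ Mstar) :
    opsYNuOfRecordV4PE N θ Mstar 𝔯 𝔢 𝔴 𝔈 x =
      operatorLayerYSectE (Matrix (Fin N) (Fin N) ℂ) (specialUnitaryUnits (Fin N)) x
        (opsYS349NuOfLetters N θ Mstar (lettersYOfRecordV4P N θ Mstar 𝔯) 𝔈 x) (lettersYOfRecordV4P N θ Mstar 𝔯 x) (𝔢 x) (𝔴 x) := rfl

/-- ★ ROWS 17, 20–23, 26: the operator-kernel fields of the plain v4P instance ARE def-Y's base readings `opsYOfLetters` of the v4P letters of record.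
[cite: Balaban1985BackgroundPropagators, Thms 3.1–3.14 pp.397–427, bookkeeping] -/
theorem opsYOfRecordV4PE_letters (x : MemberY θ.d₆ θ.ℓ₆ θ.hd' θ.hL' θ.b₀ θ.b₁ Mstar) :
    (opsYOfRecordV4PE N θ Mstar 𝔯 𝔢 𝔴 𝔈 x).Gp = (opsYOfLetters N θ Mstar (lettersYOfRecordV4P N θ Mstar 𝔯) 𝔈 x).Gp ∧
      (opsYOfRecordV4PE N θ Mstar 𝔯 𝔢 𝔴 𝔈 x).GA = (opsYOfLetters N θ Mstar (lettersYOfRecordV4P N θ Mstar 𝔯) 𝔈 x).GA ∧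
      (opsYOfRecordV4PE N θ Mstar 𝔯 𝔢 𝔴 𝔈 x).Cinv = (opsYOfLetters N θ Mstar (lettersYOfRecordV4P N θ Mstar 𝔯) 𝔈 x).Cinv ∧
      (opsYOfRecordV4PE N θ Mstar 𝔯 𝔢 𝔴 𝔈 x).GD = (opsYOfLetters N θ Mstar (lettersYOfRecordV4P N θ Mstar 𝔯) 𝔈 x).GD ∧
      (opsYOfRecordV4PE N θ Mstar 𝔯 𝔢 𝔴 𝔈 x).G₁ = (opsYOfLetters N θ Mstar (lettersYOfRecordV4P N θ Mstar 𝔯) 𝔈 x).G₁ ∧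
      (opsYOfRecordV4PE N θ Mstar 𝔯 𝔢 𝔴 𝔈 x).H = (opsYOfLetters N θ Mstar (lettersYOfRecordV4P N θ Mstar 𝔯) 𝔈 x).H ∧
      (opsYOfRecordV4PE N θ Mstar 𝔯 𝔢 𝔴 𝔈 x).H₁ = (opsYOfLetters N θ Mstar (lettersYOfRecordV4P N θ Mstar 𝔯) 𝔈 x).H₁ ∧
      (opsYOfRecordV4PE N θ Mstar 𝔯 𝔢 𝔴 𝔈 x).GG = (opsYOfLetters N θ Mstar (lettersYOfRecordV4P N θ Mstar 𝔯) 𝔈 x).GG ∧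
      (opsYOfRecordV4PE N θ Mstar 𝔯 𝔢 𝔴 𝔈 x).Kdiff = (opsYOfLetters N θ Mstar (lettersYOfRecordV4P N θ Mstar 𝔯) 𝔈 x).Kdiff ∧
      (opsYOfRecordV4PE N θ Mstar 𝔯 𝔢 𝔴 𝔈 x).QGQinv = (opsYOfLetters N θ Mstar (lettersYOfRecordV4P N θ Mstar 𝔯) 𝔈 x).QGQinv ∧
      (opsYOfRecordV4PE N θ Mstar 𝔯 𝔢 𝔴 𝔈 x).QG1Qinv = (opsYOfLetters N θ Mstar (lettersYOfRecordV4P N θ Mstar 𝔯) 𝔈 x).QG1Qinv :=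
  ⟨rfl, rfl, rfl, rfl, rfl, rfl, rfl, rfl, rfl, rfl, rfl⟩

/-- ★ the operator-kernel fields of the `ν`-read v4P instance ARE def-Y's base readings `opsYOfLetters` of the v4P letters of record, except the two
(3.132) kernels (below).
[cite: Balaban1985BackgroundPropagators, Thms 3.1–3.14 pp.397–427, bookkeeping] -/
theorem opsYNuOfRecordV4PE_letters (x : MemberY θ.d₆ θ.ℓ₆ θ.hd' θ.hL' θ.b₀ θ.b₁ Mstar) :
    (opsYNuOfRecordV4PE N θ Mstar 𝔯 𝔢 𝔴 𝔈 x).Gp = (opsYOfLetters N θ Mstar (lettersYOfRecordV4P N θ Mstar 𝔯) 𝔈 x).Gp ∧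
      (opsYNuOfRecordV4PE N θ Mstar 𝔯 𝔢 𝔴 𝔈 x).GA = (opsYOfLetters N θ Mstar (lettersYOfRecordV4P N θ Mstar 𝔯) 𝔈 x).GA ∧
      (opsYNuOfRecordV4PE N θ Mstar 𝔯 𝔢 𝔴 𝔈 x).Cinv = (opsYOfLetters N θ Mstar (lettersYOfRecordV4P N θ Mstar 𝔯) 𝔈 x).Cinv ∧
      (opsYNuOfRecordV4PE N θ Mstar 𝔯 𝔢 𝔴 𝔈 x).GD = (opsYOfLetters N θ Mstar (lettersYOfRecordV4P N θ Mstar 𝔯) 𝔈 x).GD ∧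
      (opsYNuOfRecordV4PE N θ Mstar 𝔯 𝔢 𝔴 𝔈 x).G₁ = (opsYOfLetters N θ Mstar (lettersYOfRecordV4P N θ Mstar 𝔯) 𝔈 x).G₁ ∧
      (opsYNuOfRecordV4PE N θ Mstar 𝔯 𝔢 𝔴 𝔈 x).H = (opsYOfLetters N θ Mstar (lettersYOfRecordV4P N θ Mstar 𝔯) 𝔈 x).H ∧
      (opsYNuOfRecordV4PE N θ Mstar 𝔯 𝔢 𝔴 𝔈 x).H₁ = (opsYOfLetters N θ Mstar (lettersYOfRecordV4P N θ Mstar 𝔯) 𝔈 x).H₁ ∧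
      (opsYNuOfRecordV4PE N θ Mstar 𝔯 𝔢 𝔴 𝔈 x).GG = (opsYOfLetters N θ Mstar (lettersYOfRecordV4P N θ Mstar 𝔯) 𝔈 x).GG ∧
      (opsYNuOfRecordV4PE N θ Mstar 𝔯 𝔢 𝔴 𝔈 x).Kdiff = (opsYOfLetters N θ Mstar (lettersYOfRecordV4P N θ Mstar 𝔯) 𝔈 x).Kdiff :=
  ⟨rfl, rfl, rfl, rfl, rfl, rfl, rfl, rfl, rfl⟩

/-- ★ ROW 26's two kernels at the `ν`-read v4P instance ARE the `ν`-readings of the genuine `(QG̃Q*)⁻¹ ∕ (QG₁Q*)⁻¹` FED `G′_phys`.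
[cite: Balaban1985BackgroundPropagators, (3.132) p.422, (3.129) p.421, bookkeeping] -/
theorem opsYNuOfRecordV4PE_QGQinv_QG1Qinv (x : MemberY θ.d₆ θ.ℓ₆ θ.hd' θ.hL' θ.b₀ θ.b₁ Mstar) :
    (opsYNuOfRecordV4PE N θ Mstar 𝔯 𝔢 𝔴 𝔈 x).QGQinv =
        siteKernelOfOpNu x.toKIdx (bg9Y (Matrix (Fin N) (Fin N) ℂ) (specialUnitaryUnits (Fin N)) x) (fun U => U) (nuY (θ.d₆ + 1) x.toKIdx)
          (QGQinvY x.toKIdx (parSymY x.toKIdx) (parBY x.toKIdx) (GpPhysY x.toKIdx (parSymY x.toKIdx))) ∧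
      (opsYNuOfRecordV4PE N θ Mstar 𝔯 𝔢 𝔴 𝔈 x).QG1Qinv =
        siteKernelOfOpNu x.toKIdx (bg9Y (Matrix (Fin N) (Fin N) ℂ) (specialUnitaryUnits (Fin N)) x) (fun U => U) (nuY (θ.d₆ + 1) x.toKIdx)
          (QG1QinvY x.toKIdx (parSymY x.toKIdx) (parBY x.toKIdx) (GpPhysY x.toKIdx (parSymY x.toKIdx)) (𝔯 x).Δ2) := ⟨rfl, rfl⟩

/-- ★ ROWS 24–25 at both v4P instances: `Ck` (3.187) over the v4P letters, `GivenBy3185`, `HasRWExpC`, and `P349` = n06-i's site-(3.49) reading of the v4P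
letters, which reads only `.Gp ∕ .parS` — v4's. [cite: Balaban1985BackgroundPropagators, Thm 3.15 (3.185)–(3.187) p.432, (3.49) p.399, bookkeeping] -/
theorem opsYNuOfRecordV4PE_sectE (x : MemberY θ.d₆ θ.ℓ₆ θ.hd' θ.hL' θ.b₀ θ.b₁ Mstar) :
    (opsYNuOfRecordV4PE N θ Mstar 𝔯 𝔢 𝔴 𝔈 x).Ck =
        siteKernelOfOp x.toKIdx (bg9Y (Matrix (Fin N) (Fin N) ℂ) (specialUnitaryUnits (Fin N)) x) (fun U => U)
          (CkY x (lettersYOfRecordV4P N θ Mstar 𝔯 x) (𝔢 x)) id id ∧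
      (opsYNuOfRecordV4PE N θ Mstar 𝔯 𝔢 𝔴 𝔈 x).GivenBy3185 = givenBy3185Y x (lettersYOfRecordV4P N θ Mstar 𝔯 x) (𝔢 x) ∧
      (opsYNuOfRecordV4PE N θ Mstar 𝔯 𝔢 𝔴 𝔈 x).HasRWExpC = hasRWExpCY (𝔴 x) ∧
      (opsYNuOfRecordV4PE N θ Mstar 𝔯 𝔢 𝔴 𝔈 x).P349 =
        p349SiteY (Matrix (Fin N) (Fin N) ℂ) (specialUnitaryUnits (Fin N)) x (lettersYOfRecordV4P N θ Mstar 𝔯 x) ∧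
      (opsYNuOfRecordV4PE N θ Mstar 𝔯 𝔢 𝔴 𝔈 x).P349 =
        fineKernelOfSiteOp x.toKIdx (bg9Y (Matrix (Fin N) (Fin N) ℂ) (specialUnitaryUnits (Fin N)) x) (fun U => U)
          (P349Y x.toKIdx (parSymY x.toKIdx) (GpY x.toKIdx (parSymY x.toKIdx))) ∧
      (opsYOfRecordV4PE N θ Mstar 𝔯 𝔢 𝔴 𝔈 x).Ck = (opsYNuOfRecordV4PE N θ Mstar 𝔯 𝔢 𝔴 𝔈 x).Ck ∧
      (opsYOfRecordV4PE N θ Mstar 𝔯 𝔢 𝔴 𝔈 x).GivenBy3185 = (opsYNuOfRecordV4PE N θ Mstar 𝔯 𝔢 𝔴 𝔈 x).GivenBy3185 ∧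
      (opsYOfRecordV4PE N θ Mstar 𝔯 𝔢 𝔴 𝔈 x).HasRWExpC = (opsYNuOfRecordV4PE N θ Mstar 𝔯 𝔢 𝔴 𝔈 x).HasRWExpC ∧
      (opsYOfRecordV4PE N θ Mstar 𝔯 𝔢 𝔴 𝔈 x).P349 = (opsYNuOfRecordV4PE N θ Mstar 𝔯 𝔢 𝔴 𝔈 x).P349 :=
  ⟨rfl, rfl, rfl, rfl, rfl, rfl, rfl, rfl, rfl⟩

/-- ★ the predicate ∕ expansion fields of both v4P instances are `𝔈`'s (rows 1–3, 13–16, 18–19 transport by `rfl`).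
[cite: Balaban1985BackgroundPropagators, Thms 3.4–3.13 pp.400–426, bookkeeping] -/
theorem opsYNuOfRecordV4PE_preds (x : MemberY θ.d₆ θ.ℓ₆ θ.hd' θ.hL' θ.b₀ θ.b₁ Mstar) :
    (opsYNuOfRecordV4PE N θ Mstar 𝔯 𝔢 𝔴 𝔈 x).IsAnalyticExt = (𝔈 x).IsAnalyticExt ∧ (opsYNuOfRecordV4PE N θ Mstar 𝔯 𝔢 𝔴 𝔈 x).E37 = (𝔈 x).E37 ∧
      (opsYNuOfRecordV4PE N θ Mstar 𝔯 𝔢 𝔴 𝔈 x).EK39 = (𝔈 x).EK39 ∧ (opsYNuOfRecordV4PE N θ Mstar 𝔯 𝔢 𝔴 𝔈 x).E310 = (𝔈 x).E310 ∧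
      (opsYNuOfRecordV4PE N θ Mstar 𝔯 𝔢 𝔴 𝔈 x).PosDef = (𝔈 x).PosDef ∧ (opsYNuOfRecordV4PE N θ Mstar 𝔯 𝔢 𝔴 𝔈 x).HasRWExp = (𝔈 x).HasRWExp ∧
      (opsYNuOfRecordV4PE N θ Mstar 𝔯 𝔢 𝔴 𝔈 x).HasRWExpH = (𝔈 x).HasRWExpH ∧ (opsYNuOfRecordV4PE N θ Mstar 𝔯 𝔢 𝔴 𝔈 x).PosDefK = (𝔈 x).PosDefK ∧
      (opsYOfRecordV4PE N θ Mstar 𝔯 𝔢 𝔴 𝔈 x).IsAnalyticExt = (𝔈 x).IsAnalyticExt ∧ (opsYOfRecordV4PE N θ Mstar 𝔯 𝔢 𝔴 𝔈 x).E37 = (𝔈 x).E37 ∧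
      (opsYOfRecordV4PE N θ Mstar 𝔯 𝔢 𝔴 𝔈 x).EK39 = (𝔈 x).EK39 ∧ (opsYOfRecordV4PE N θ Mstar 𝔯 𝔢 𝔴 𝔈 x).E310 = (𝔈 x).E310 ∧
      (opsYOfRecordV4PE N θ Mstar 𝔯 𝔢 𝔴 𝔈 x).PosDef = (𝔈 x).PosDef ∧ (opsYOfRecordV4PE N θ Mstar 𝔯 𝔢 𝔴 𝔈 x).HasRWExp = (𝔈 x).HasRWExp ∧
      (opsYOfRecordV4PE N θ Mstar 𝔯 𝔢 𝔴 𝔈 x).HasRWExpH = (𝔈 x).HasRWExpH ∧ (opsYOfRecordV4PE N θ Mstar 𝔯 𝔢 𝔴 𝔈 x).PosDefK = (𝔈 x).PosDefK :=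
  ⟨rfl, rfl, rfl, rfl, rfl, rfl, rfl, rfl, rfl, rfl, rfl, rfl, rfl, rfl, rfl, rfl⟩

/-- the [B9] bundle of record at the `ν`-read v4P instance. [cite: Balaban1985BackgroundPropagators, Thms 3.1–3.15 pp.397–432, bookkeeping] -/
theorem Y9OfRecord_opsYNuOfRecordV4PE :
    Y9OfRecord N θ Mstar (opsYNuOfRecordV4PE N θ Mstar 𝔯 𝔢 𝔴 𝔈) =
      carriersY θ.d₆ θ.ℓ₆ θ.hd' θ.hL' θ.b₀ θ.b₁ Mstar (Matrix (Fin N) (Fin N) ℂ) (specialUnitaryUnits (Fin N)) (opsYNuOfRecordV4PE N θ Mstar 𝔯 𝔢 𝔴 𝔈) :=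
  rfl

/-- the [B9] bundle of record at the plain v4P instance. [cite: Balaban1985BackgroundPropagators, Thms 3.1–3.15 pp.397–432, bookkeeping] -/
theorem Y9OfRecord_opsYOfRecordV4PE :
    Y9OfRecord N θ Mstar (opsYOfRecordV4PE N θ Mstar 𝔯 𝔢 𝔴 𝔈) =
      carriersY θ.d₆ θ.ℓ₆ θ.hd' θ.hL' θ.b₀ θ.b₁ Mstar (Matrix (Fin N) (Fin N) ℂ) (specialUnitaryUnits (Fin N)) (opsYOfRecordV4PE N θ Mstar 𝔯 𝔢 𝔴 𝔈) :=
  rfl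

/-- at the FLAT Sect. E family the `ν`-read v4P instance's `Ck` kernel vanishes identically (row 24's honesty guard, first half).
[cite: Balaban1985BackgroundPropagators, Thm 3.15 (3.187) p.432, bookkeeping] -/
theorem opsYNuOfRecordV4PE_Ck_ker_flat (x : MemberY θ.d₆ θ.ℓ₆ θ.hd' θ.hL' θ.b₀ θ.b₁ Mstar)
    (U : (bg9Y (Matrix (Fin N) (Fin N) ℂ) (specialUnitaryUnits (Fin N)) x).Cfg) (y y' : (geo9Y x).Site) :
    (opsYNuOfRecordV4PE N θ Mstar 𝔯 (sectEY_flat N θ Mstar) 𝔴 𝔈 x).Ck.ker U y y' = 0 :=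
  operatorLayerYSectE_Ck_ker_flat x (opsYS349NuOfLetters N θ Mstar (lettersYOfRecordV4P N θ Mstar 𝔯) 𝔈 x) (lettersYOfRecordV4P N θ Mstar 𝔯 x) (𝔴 x) U y y'

/-- ★ **ROW 24 (`t315`) AT THE `ν`-READ v4P INSTANCE, UNFOLDED** (`Iff.rfl`) — the named binder the certificate displays for row 24.
[cite: Balaban1985BackgroundPropagators, Thm 3.15 (3.185)–(3.187) p.432] -/
theorem t315_opsYNuOfRecordV4PE_iff :
    B9.Thm315FullPrinted c35Y geo9Y (bg9Y (Matrix (Fin N) (Fin N) ℂ) (specialUnitaryUnits (Fin N)))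
        (fun x => (opsYNuOfRecordV4PE N θ Mstar 𝔯 𝔢 𝔴 𝔈 x).Ck) inΛY unitDistY
        (fun x => (opsYNuOfRecordV4PE N θ Mstar 𝔯 𝔢 𝔴 𝔈 x).GivenBy3185) (fun x => (opsYNuOfRecordV4PE N θ Mstar 𝔯 𝔢 𝔴 𝔈 x).HasRWExpC) ↔
      B9.Thm315FullPrinted c35Y geo9Y (bg9Y (Matrix (Fin N) (Fin N) ℂ) (specialUnitaryUnits (Fin N)))
        (fun x => siteKernelOfOp x.toKIdx (bg9Y (Matrix (Fin N) (Fin N) ℂ) (specialUnitaryUnits (Fin N)) x) (fun U => U)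
          (CkY x (lettersYOfRecordV4P N θ Mstar 𝔯 x) (𝔢 x)) id id) inΛY unitDistY
        (fun x => givenBy3185Y x (lettersYOfRecordV4P N θ Mstar 𝔯 x) (𝔢 x)) (fun x => hasRWExpCY (𝔴 x)) := Iff.rfl

/-- THE HONESTY GUARD at v4P: at the FLAT Sect. E letters and the FLAT walk letters row 24 holds OUTRIGHT at the `ν`-read instance (content enters exactly
with genuine letters). [cite: Balaban1985BackgroundPropagators, Thm 3.15 (3.185)–(3.187) p.432, bookkeeping] -/
theorem t315_opsYNuOfRecordV4PE_flat {δ₀ : ℝ} (hδ₀ : 0 < δ₀) :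
    B9.Thm315FullPrinted c35Y geo9Y (bg9Y (Matrix (Fin N) (Fin N) ℂ) (specialUnitaryUnits (Fin N)))
      (fun x => (opsYNuOfRecordV4PE N θ Mstar 𝔯 (sectEY_flat N θ Mstar) (rwEY_flat N θ Mstar) 𝔈 x).Ck) inΛY
      B9PinGeometryKLevelV1.unitDistY
      (fun x => (opsYNuOfRecordV4PE N θ Mstar 𝔯 (sectEY_flat N θ Mstar) (rwEY_flat N θ Mstar) 𝔈 x).GivenBy3185)
      (fun x => (opsYNuOfRecordV4PE N θ Mstar 𝔯 (sectEY_flat N θ Mstar) (rwEY_flat N θ Mstar) 𝔈 x).HasRWExpC) :=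
  ⟨δ₀, 1, 1, hδ₀, one_pos, one_pos, fun x _ _ _ U _ _ =>
    ⟨givenBy3185Y_flat x _ U, hasRWExpCY_flat _ _ x U δ₀, fun y y' _ _ => by
      rw [opsYNuOfRecordV4PE_Ck_ker_flat, abs_zero]
      exact mul_nonneg zero_le_one (Real.exp_nonneg _)⟩⟩

end Record

end

end Literature.MathematicalPhysics.QuantumFieldTheory.Balaban1983to89.Node00
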